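import Literature.Algebra.EuclideanLattices.IndecomposableSplitting
import Literature.Geometry.Kaehler.ComplexTorusPolarizedDecompositionFinite
import Literature.Geometry.Kaehler.ComplexTorusBuserSarnakInvariant
import Mathlib.LinearAlgebra.Dimension.Finite
import HarnessLib

/-!
# Uniqueness of the decomposition of a polarised complex torus into indecomposable polarised
# abelian subvarieties (Debarre 1996, Théorème 1 and Corollaire 2)

Layer `Literature/Geometry/Kaehler`, namespace `Literature.Geometry.Kaehler.ComplexTorus`; lane `lit-hodgefound`
(Track 2 foundations library, Layer A2 «polarisations … Poincaré reducibility / products of polarised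
tori»), seat p16, row g14-#1 FILE 2. Definitions with bodies + theorems; NO named fact, net debt `0`.

## Source, VERBATIM

O. Debarre, *Polarisations sur les variétés abéliennes produits*, C. R. Acad. Sci. Paris Sér. I **323**
(1996) 631–635 [Debarre1996PolarisationsProduits] (author's copy materialised as `paper:url-cf01ad14f74f`,
erratum `paper:url-54cc67cadfdc`): "On dit qu'une variété abélienne polarisée est *indécomposable* si elle
n'est ni nulle, ni isomorphe au produit de deux variétés abéliennes polarisées non nulles. Toute variété
abélienne polarisée non nulle se décompose en produit de sous-variétés abéliennes polarisées
indécomposables. Le but de cette note est de montrer que cette décomposition est unique." —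
"**Théorème 1.** Soit `(X, θ)` une variété abélienne polarisée contenant des sous-variétés abéliennes
`X₁, X₂, Y₁` et `Y₂` telles que `(X, θ) = (X₁, θ|X₁) × (X₂, θ|X₂) = (Y₁, θ|Y₁) × (Y₂, θ|Y₂)`. Pour
`i = 1, 2`, on a `(Xᵢ, θ|Xᵢ) ≃ (Xᵢ ∩ Y₁, θ|Xᵢ∩Y₁) × (Xᵢ ∩ Y₂, θ|Xᵢ∩Y₂)`." — "**Corollaire 2.** Soit
`(X, θ)` une variété abélienne polarisée contenant des sous-variétés abéliennes `X₁, …, X_r` et `Y₁, …, Y_s`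
telles que `(X, θ) = ∏ᵢ₌₁ʳ (Xᵢ, θ|Xᵢ) = ∏ⱼ₌₁ˢ (Yⱼ, θ|Yⱼ)` [erratum]. a) Si `(X₁, θ|X₁), …, (X_r, θ|X_r)`
sont indécomposables, il existe une partition `I₁ ⊔ … ⊔ I_s` de `{1, …, r}` telle que
`(Yⱼ, θ|Yⱼ) = ∏_{i ∈ Iⱼ} (Xᵢ, θ|Xᵢ)`, pour tout `j = 1, …, s`. b) Si `(X₁, θ|X₁), …, (X_r, θ|X_r)` et
`(Y₁, θ|Y₁), …, (Y_s, θ|Y_s)` sont indécomposables, on a `r = s` et il existe une permutation `σ` de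
`{1, …, s}` telle que `Yⱼ = X_{σ(j)}` pour tout `j`."

Debarre proves Théorème 1 by an `h⁰`/Riemann–Roch count ("J.-P. Serre […] a indépendamment obtenu une
démonstration différente du théorème 1"); the principally polarised case is Shimura's, via the
irreducible components of `Θ` (Clemens–Griffiths 1972, Lemma 3.20; Jordan–Keeton–Poonen arXiv:1602.06811:
"Shimura proved that each principally polarized abelian variety over `ℂ` admits a unique factorization
into irreducible principally polarized abelian varieties"). The proof FORMALISED HERE is the lattice one:
the Eichler–Kneser unique indecomposable splitting of a definite lattice (O'Meara 1963, § 105 Thm 105:1;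
FILE 1 `Literature/Algebra/EuclideanLattices/IndecomposableSplitting`) applied to `Λ = ℤ^ι` with the
positive-definite HERMITIAN form `H = E(i·, ·) + iE` of the polarisation (Lange 2023, Lemma 1.2.10;
the tree's `hermOf`).

## Reading (carriers of the tree; row g13-#1 `ComplexTorusPolarizedDecomposition`)

A polarised torus is `(X = E/Φ(ℤ^ι), η)` with `η` a Riemann form (`IsRiemannForm Φ η`). By g13-#1, «`(X, η)` is
the product of the polarised abelian subvarieties on `V` and `W`» is the INTERNAL condition
`IsProductPair Φ η V W` on two real subspaces of `Λ ⊗ ℝ = ℝ^ι` (complex lattice subspaces, complementary,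
`η`-orthogonal, `Λ = (Λ ∩ V) ⊕ (Λ ∩ W)`), equivalent to an EXTERNAL isomorphism of polarised tori with a
product. Accordingly: an `r`-fold decomposition `(X, η) = ∏ᵢ (Xᵢ, η|Xᵢ)` is a family
`V : κ → Submodule ℝ (ι → ℝ)` with `IsProductFamily Φ η V`; a decomposition OF THE SUBVARIETY on `U` is
`IsProductPairIn Φ η U V W`; «`(X_U, η|U)` indécomposable» is `IsIndecomposable Φ η U` (non-zero, no product
pair inside `U`). KEY DICTIONARY: for complex subspaces `η`-orthogonality is `H`-orthogonality
(`isOrtho_subLattice`), and conversely the real spans of an `H`-orthogonal splitting of `Λ` are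
automatically COMPLEX (`isComplexSubspace_of_sup_eq`): so product families of `(X, η)` ARE orthogonal
splittings of the definite hermitian lattice `(Λ, H)` (`IsProductFamily.isOrthogonalDecomposition`,
`isProductFamily_sublatticeSpan`), indecomposability matches (`isIndecomposable_iff`), and Debarre's statements
are the image of O'Meara's 105:1.

## Contents (all PROVED; `hη : IsRiemannForm Φ η` where needed)

* § 1 `hermFormZ Φ η : (ι → ℤ) →ₗ[ℤ] (ι → ℤ) →ₗ[ℤ] ℂ` (`H` on `Λ`), `hermNormSq`, **`IsRiemannForm.isDefinite_hermFormZ`**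
  (symmetry, Pythagoras, positivity, and finiteness of the lattice vectors of bounded `H`-norm =
  `IsRiemannForm.finite_setOf_hodgeNormSq_latticeVec_le`); the real polar form `hodgeBilin` (`Re H`) and
  `latticeBilin` (`E`) on `ℝ^ι`.
* § 2 `sublatticeSpan N` (the real span of a sublattice), `subLattice`/`sublatticeSpan` bookkeeping,
  `isOrtho_subLattice` (`η`-orthogonal complex subspaces have `H`-orthogonal lattices),
  `orthogonal_sublatticeSpan` / `hodgeBilin_sublatticeSpan` (`H`-orthogonal sublattices have `E`- and `Re H`-orthogonal
  spans), `mem_of_sup_eq_of_orthogonal`, **`isComplexSubspace_of_sup_eq`** (the summands of an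
  `H`-orthogonal splitting of a complex lattice subspace are complex).
* § 3 `IsProductFamily`, `IsProductPairIn`, `isProductPairIn_top_iff` (`= IsProductPair`),
  `IsIndecomposable`, `isIndecomposable_top_iff` (`↔ ¬ IsPolarizedDecomposable`).
* § 4 the dictionary: `IsProductFamily.isOrthogonalDecomposition`, `IsIndecomposable.subLattice`,
  `isIndecomposable_of_subLattice`, **`isIndecomposable_iff`**, `isProductFamily_sublatticeSpan`,
  `subLattice_sublatticeSpan_eq`.
* § 5 EXISTENCE: `polarizedComponents Φ η`, **`isProductFamily_polarizedComponents`**,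
  `isIndecomposable_of_mem_polarizedComponents`, `finite_polarizedComponents` ("toute variété abélienne
  polarisée non nulle se décompose en produit de sous-variétés abéliennes polarisées indécomposables").
* § 6 UNIQUENESS: **`IsProductFamily.range_eq_polarizedComponents`**, `IsProductFamily.injective`,
  **`debarre1996_corollaire_2b`** (`r = s` and `Yⱼ = X_{σ(j)}`), **`debarre1996_corollaire_2a`**
  (the partition), **`debarre1996_theoreme_1`** (`Xᵢ = (Xᵢ ∩ Y₁) × (Xᵢ ∩ Y₂)`),
  `existsUnique_isProductFamily_isIndecomposable`.
* § 7 validation: `isIndecomposable_of_finrank_eq_two` (elliptic-curve factors are indecomposable),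
  `isIndecomposable_top_of_card_lt_four`, `polarizedComponents_eq_singleton_top`,
  `IsProductPair.polarizedComponents_eq_pair`.

## Honest scope — NOT here

* Debarre works over any algebraically closed field; here `ℂ` (complex tori with a Riemann form).
* «indécomposable» is rendered internally (`IsIndecomposable Φ η U`: no product pair inside `U`); its
  equivalence with «the polarised torus `(Y_U, η|_U)` on the carrier `subtorusPeriod Φ U` is not
  `IsPolarizedIso` to a product of two non-zero polarised tori» is g13-#1's
  `IsPolarizedIso.isPolarizedDecomposable_iff` transported along `subtorusMatrix U` — not restated here
  (for `U = ⊤` it is `isIndecomposable_top_iff`).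
* Debarre's § 2 (Thm 3 / Cor 4: `h⁰(X, L) ≤ ∏ h⁰(Xᵢ, L|Xᵢ)`, splitting criterion) is a different statement.
-- TODO(general form): arbitrary algebraically closed ground field (Debarre); the analytic proof is ℂ-only.

## References

* [Debarre1996PolarisationsProduits] O. Debarre, *Polarisations sur les variétés abéliennes produits*,
  C. R. Acad. Sci. Paris Sér. I Math. 323 (1996), no. 6, 631–635, Théorème 1, Corollaire 2 (+ erratum);
  zbl 0879.14019.
* [Omeara1963] O. T. O'Meara, *Introduction to Quadratic Forms* (1963), § 105 Thm 105:1 (FILE 1).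
* [Lange2023AbelianVarietiesComplex] H. Lange, *Abelian Varieties over the Complex Numbers* (2023),
  §1.2.2 Lemma 1.2.10 (`H = E(i·,·) + iE`), §2.4.4 Cor. 2.4.24 / 2.4.31 (products of polarised abelian
  subvarieties).
* [ClemensGriffiths1972] C. H. Clemens, P. A. Griffiths, Ann. of Math. 95 (1972), Lemma 3.20 (principal case).
-/

noncomputable section

open Module Function Submodule Complex Set
open Literature.Algebra.EuclideanLattices

namespace Literature.Geometry.Kaehler

namespace ComplexTorus

variable {ι : Type*} {E : Type*} [NormedAddCommGroup E] [NormedSpace ℂ E]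

/-! ### § 0 Helpers -/

section Helpers

/-- `intVec` is additive. [folklore] -/
private theorem intVec_add₂ (m n : ι → ℤ) : intVec (m + n) = intVec m + intVec n := by
  funext i; simp [intVec]

/-- `intVec` is `ℤ`-homogeneous. [folklore] -/
private theorem intVec_zsmul₂ (c : ℤ) (m : ι → ℤ) : intVec (c • m) = (c : ℝ) • intVec m := by
  funext i; simp [intVec]

/-- `intVec 0 = 0`. [folklore] -/
private theorem intVec_zero₂ : intVec (0 : ι → ℤ) = 0 := by
  funext i; simp [intVec]

/-- `intVec m = 0 ↔ m = 0`. [folklore] -/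
private theorem intVec_eq_zero_iff₂ (m : ι → ℤ) : intVec m = 0 ↔ m = 0 := by
  constructor
  · intro h; funext i; have := congrFun h i; simpa [intVec] using this
  · rintro rfl; exact intVec_zero₂

/-- `H(w, c v) = c H(w, v)` for real `c`. [folklore] -/
private theorem hermOf_real_smul_right (η : E [⋀^Fin 2]→L[ℝ] ℝ) (c : ℝ) (v w : E) :
    hermOf η w (c • v) = (c : ℂ) * hermOf η w v := by
  simp only [hermOf, twoForm_smul_right, Complex.ofReal_mul]
  ring

/-- `subLattice` is monotone. [folklore] -/
private theorem subLattice_mono₂ {V W : Submodule ℝ (ι → ℝ)} (h : V ≤ W) : subLattice V ≤ subLattice W :=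
  fun _ hm ↦ h hm

/-- `Λ ∩ (V ⊓ W) = (Λ ∩ V) ⊓ (Λ ∩ W)`. [folklore] -/
private theorem subLattice_inf₂ (V W : Submodule ℝ (ι → ℝ)) :
    subLattice (V ⊓ W) = subLattice V ⊓ subLattice W := by
  ext m; simp [mem_subLattice_iff, mem_inf]

end Helpers

/-! ### § 1 The hermitian form `H` of the polarisation on the lattice `Λ = ℤ^ι` -/

section HermForm

variable (Φ : (ι → ℝ) ≃L[ℝ] E) (η : E [⋀^Fin 2]→L[ℝ] ℝ)

/-- **`H` on the lattice**: `H(m, n) = η(iΦm, Φn) + iη(Φm, Φn)` for `m, n ∈ Λ = ℤ^ι` — Lange's hermitian form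
`H = E(i·, ·) + iE` of `E = η` (the tree's `hermOf`) restricted to the period lattice, as a `ℤ`-bilinear
`ℂ`-valued form. [cite: Lange2023AbelianVarietiesComplex, §1.2.2 Lemma 1.2.10] -/
def hermFormZ : (ι → ℤ) →ₗ[ℤ] (ι → ℤ) →ₗ[ℤ] ℂ :=
  LinearMap.mk₂ ℤ (fun m n ↦ hermOf η (Φ (intVec m)) (Φ (intVec n)))
    (fun m m' n ↦ by simp only [intVec_add₂, map_add, hermOf_add_left])
    (fun c m n ↦ by
      rw [intVec_zsmul₂, map_smul, hermOf_real_smul_left, zsmul_eq_mul, Complex.ofReal_intCast])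
    (fun m n n' ↦ by simp only [intVec_add₂, map_add, hermOf_add_right])
    (fun c m n ↦ by
      rw [intVec_zsmul₂, map_smul, hermOf_real_smul_right, zsmul_eq_mul, Complex.ofReal_intCast])

/-- Unfolding of `hermFormZ`. [cite: Lange2023AbelianVarietiesComplex, §1.2.2 Lemma 1.2.10] -/
@[simp] theorem hermFormZ_apply (m n : ι → ℤ) :
    hermFormZ Φ η m n = hermOf η (Φ (intVec m)) (Φ (intVec n)) :=
  rfl

/-- `H(m, n) = 0` iff both `Re H = η(iΦm, Φn)` and `Im H = η(Φm, Φn)` vanish.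
[cite: Lange2023AbelianVarietiesComplex, §1.2.2 Lemma 1.2.10] -/
theorem hermFormZ_eq_zero_iff (m n : ι → ℤ) :
    hermFormZ Φ η m n = 0 ↔ η ![I • Φ (intVec m), Φ (intVec n)] = 0 ∧ η ![Φ (intVec m), Φ (intVec n)] = 0 := by
  rw [hermFormZ_apply, Complex.ext_iff, hermOf_re, hermOf_im]
  simp

/-- **The `H`-norm on the lattice**: `‖m‖²_H = H(m, m) = η(iΦm, Φm)` (`= hodgeNormSq η (Φ m)`).
[cite: Lange2023AbelianVarietiesComplex, §1.2.2 Lemma 1.2.10] -/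
def hermNormSq (m : ι → ℤ) : ℝ :=
  hodgeNormSq η (latticeVec Φ m)

/-- Unfolding of `hermNormSq`. [cite: Lange2023AbelianVarietiesComplex, §1.2.2 Lemma 1.2.10] -/
theorem hermNormSq_apply (m : ι → ℤ) : hermNormSq Φ η m = η ![I • Φ (intVec m), Φ (intVec m)] :=
  rfl

variable {Φ η}

/-- `H(m, n) = 0 ⇒ H(n, m) = 0` on the lattice (`H` is hermitian for `η` of type `(1,1)`).
[cite: Lange2023AbelianVarietiesComplex, §1.2.2 Lemma 1.2.10] -/
theorem IsRiemannForm.hermFormZ_symm_zero (hη : IsRiemannForm Φ η) (m n : ι → ℤ)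
    (h : hermFormZ Φ η m n = 0) : hermFormZ Φ η n m = 0 := by
  rw [hermFormZ_apply] at h ⊢
  rw [hermOf_swap η hη.1, h, map_zero]

/-- **`(Λ, H)` is a definite lattice** in the sense of FILE 1 when `η` is a Riemann form: `H` is hermitian
(so `H(m, n) = 0 ⇒ H(n, m) = 0`), Pythagoras `‖m + n‖² = ‖m‖² + ‖n‖²` for `H(m, n) = 0`, `‖m‖² > 0` for
`m ≠ 0`, and only finitely many lattice vectors have bounded `H`-norm.
[cite: Lange2023AbelianVarietiesComplex, §1.2.2 Lemma 1.2.10 (H hermitian positive definite)] -/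
theorem IsRiemannForm.isDefinite_hermFormZ [Fintype ι] (hη : IsRiemannForm Φ η) :
    IndecomposableSplitting.IsDefinite (hermFormZ Φ η) (hermNormSq Φ η) where
  symm_zero := hη.hermFormZ_symm_zero
  add_of_orth m n h := by
    rw [hermFormZ_eq_zero_iff] at h
    have hsymm := polarForm_symm (η := η) hη.1 (Φ (intVec n)) (Φ (intVec m))
    change hodgeNormSq η (Φ (intVec (m + n))) = hodgeNormSq η (Φ (intVec m)) + hodgeNormSq η (Φ (intVec n))
    rw [intVec_add₂, map_add, hodgeNormSq_add, hsymm, h.1, add_zero, add_zero]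
  pos m hm := by
    refine hη.hodgeNormSq_pos fun h0 ↦ hm ?_
    exact (latticeVec_eq_zero_iff Φ m).1 h0
  finite_le c := hη.finite_setOf_hodgeNormSq_latticeVec_le c

variable (Φ η)

/-- **The real polar form `Re H(x, y) = η(iΦx, Φy)`** on `Λ ⊗ ℝ = ℝ^ι` as a bilinear form.
[cite: Lange2023AbelianVarietiesComplex, §1.2.2 Lemma 1.2.10 (`Re H` is symmetric bilinear)] -/
def hodgeBilin : (ι → ℝ) →ₗ[ℝ] (ι → ℝ) →ₗ[ℝ] ℝ :=
  LinearMap.mk₂ ℝ (fun x y ↦ η ![I • Φ x, Φ y])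
    (fun x x' y ↦ by rw [map_add, smul_add, twoForm_add_left])
    (fun c x y ↦ by rw [map_smul, smul_comm, twoForm_smul_left, smul_eq_mul])
    (fun x y y' ↦ by rw [map_add, twoForm_add_right])
    (fun c x y ↦ by rw [map_smul, twoForm_smul_right, smul_eq_mul])

/-- Unfolding of `hodgeBilin`. [cite: Lange2023AbelianVarietiesComplex, §1.2.2 Lemma 1.2.10] -/
@[simp] theorem hodgeBilin_apply (x y : ι → ℝ) : hodgeBilin Φ η x y = η ![I • Φ x, Φ y] := rfl

/-- **The alternating form `E(x, y) = η(Φx, Φy)`** on `ℝ^ι` as a bilinear map (the tree's `latticeBilin`,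
re-packaged as `LinearMap.mk₂` for the orthogonality calculus of FILE 1).
[cite: Lange2023AbelianVarietiesComplex, §1.5.1 (the alternating form on `Λ ⊗ ℝ`)] -/
def imBilin : (ι → ℝ) →ₗ[ℝ] (ι → ℝ) →ₗ[ℝ] ℝ :=
  LinearMap.mk₂ ℝ (fun x y ↦ η ![Φ x, Φ y])
    (fun x x' y ↦ by rw [map_add, twoForm_add_left])
    (fun c x y ↦ by rw [map_smul, twoForm_smul_left, smul_eq_mul])
    (fun x y y' ↦ by rw [map_add, twoForm_add_right])
    (fun c x y ↦ by rw [map_smul, twoForm_smul_right, smul_eq_mul])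

/-- Unfolding of `imBilin`. [cite: Lange2023AbelianVarietiesComplex, §1.5.1] -/
@[simp] theorem imBilin_apply (x y : ι → ℝ) : imBilin Φ η x y = η ![Φ x, Φ y] := rfl

/-- `E(x, y) = 0 ⇒ E(y, x) = 0` (antisymmetry). [cite: Lange2023AbelianVarietiesComplex, §1.2.2 Lemma 1.2.10] -/
theorem imBilin_symm_zero (x y : ι → ℝ) (h : imBilin Φ η x y = 0) : imBilin Φ η y x = 0 := by
  rw [imBilin_apply] at h ⊢
  rw [twoForm_swap, h, neg_zero]

variable {Φ η}

/-- `Re H(x, y) = 0 ⇒ Re H(y, x) = 0` (symmetry for a form of type `(1,1)`).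
[cite: Lange2023AbelianVarietiesComplex, §1.2.2 Lemma 1.2.10] -/
theorem hodgeBilin_symm_zero (h11 : ∀ u v : E, η ![I • u, I • v] = η ![u, v]) (x y : ι → ℝ)
    (h : hodgeBilin Φ η x y = 0) : hodgeBilin Φ η y x = 0 := by
  rw [hodgeBilin_apply] at h ⊢
  rw [polarForm_symm (η := η) h11, h]

/-- `Re H(Jx, y) = -E(x, y)` for the complex structure `J = Φ⁻¹ i Φ`.
[cite: Lange2023AbelianVarietiesComplex, §1.2.2 Lemma 1.2.10] -/
theorem hodgeBilin_J (x y : ι → ℝ) :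
    hodgeBilin Φ η (Φ.symm (I • Φ x)) y = -imBilin Φ η x y := by
  rw [hodgeBilin_apply, imBilin_apply, ContinuousLinearEquiv.apply_symm_apply, smul_smul, I_mul_I,
    neg_one_smul, ← neg_one_smul ℝ (Φ x), twoForm_smul_left, neg_one_mul]

/-- `Re H(x, x) = 0 ⇒ x = 0` for a Riemann form. [cite: Lange2023AbelianVarietiesComplex, §1.2.2 Lemma 1.2.10 (positive definite)] -/
theorem IsRiemannForm.eq_zero_of_hodgeBilin_self (hη : IsRiemannForm Φ η) {x : ι → ℝ}
    (h : hodgeBilin Φ η x x = 0) : x = 0 := by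
  rw [hodgeBilin_apply] at h
  have : Φ x = 0 := hη.eq_zero_of_apply_eq_zero h
  simpa using this

end HermForm

/-! ### § 2 Real spans of sublattices; complexness of `H`-orthogonal summands -/

section RealSpan

variable (Φ : (ι → ℝ) ≃L[ℝ] E) (η : E [⋀^Fin 2]→L[ℝ] ℝ)

/-- **The real span `N ⊗ ℝ ⊆ Λ ⊗ ℝ`** of a sublattice `N ≤ Λ` (a lattice subspace by definition).
[cite: Lange2023AbelianVarietiesComplex, §1.1.6 Exercise (2)(a) ("the image of `Λ' ⊗ ℝ → V`"), p. 26] -/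
def sublatticeSpan (N : Submodule ℤ (ι → ℤ)) : Submodule ℝ (ι → ℝ) :=
  span ℝ (intVec '' (N : Set (ι → ℤ)))

/-- `sublatticeSpan N` is a lattice subspace. [cite: Lange2023AbelianVarietiesComplex, §1.1.6 Exercise (2)(a), p. 26] -/
theorem isLatticeSubspace_sublatticeSpan (N : Submodule ℤ (ι → ℤ)) : IsLatticeSubspace (sublatticeSpan N) :=
  ⟨N, rfl⟩

/-- Lattice vectors of `N` lie in `sublatticeSpan N`. [cite: Lange2023AbelianVarietiesComplex, §1.1.6 Exercise (2)(a), p. 26] -/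
theorem intVec_mem_sublatticeSpan {N : Submodule ℤ (ι → ℤ)} {m : ι → ℤ} (hm : m ∈ N) : intVec m ∈ sublatticeSpan N :=
  subset_span ⟨m, hm, rfl⟩

/-- `N ≤ Λ ∩ (N ⊗ ℝ)`. [cite: Lange2023AbelianVarietiesComplex, §1.1.6 Exercise (2)(a), p. 26] -/
theorem le_subLattice_sublatticeSpan (N : Submodule ℤ (ι → ℤ)) : N ≤ subLattice (sublatticeSpan N) :=
  fun _ hm ↦ intVec_mem_sublatticeSpan hm

/-- `sublatticeSpan` is monotone. [cite: Lange2023AbelianVarietiesComplex, §1.1.6 Exercise (2)(a), p. 26] -/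
theorem sublatticeSpan_mono {N N' : Submodule ℤ (ι → ℤ)} (h : N ≤ N') : sublatticeSpan N ≤ sublatticeSpan N' :=
  span_mono (image_mono h)

/-- A lattice subspace is the real span of its lattice: `V = (Λ ∩ V) ⊗ ℝ`.
[cite: LangeBirkenhake1992, Exercise 1.1.6 (2)(a)] -/
theorem sublatticeSpan_subLattice {V : Submodule ℝ (ι → ℝ)} (hV : IsLatticeSubspace V) : sublatticeSpan (subLattice V) = V :=
  span_intVec_subLattice hV

/-- `sublatticeSpan N = 0 ↔ N = 0`. [cite: Lange2023AbelianVarietiesComplex, §1.1.6 Exercise (2)(a), p. 26] -/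
theorem sublatticeSpan_eq_bot_iff {N : Submodule ℤ (ι → ℤ)} : sublatticeSpan N = ⊥ ↔ N = ⊥ := by
  constructor
  · intro h
    rw [eq_bot_iff]
    intro m hm
    have : intVec m ∈ (⊥ : Submodule ℝ (ι → ℝ)) := h ▸ intVec_mem_sublatticeSpan hm
    rw [mem_bot] at this ⊢
    exact (intVec_eq_zero_iff₂ m).1 this
  · rintro rfl
    rw [sublatticeSpan, eq_bot_iff, span_le]
    rintro _ ⟨m, hm, rfl⟩
    rw [SetLike.mem_coe, mem_bot] at hm
    simp [hm, intVec_zero₂]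

/-- Lattice vectors of a supremum of sublattices lie in the supremum of subspaces containing their
images (additivity of `intVec` along `Submodule.iSup_induction`). [folklore] -/
private theorem intVec_mem_iSup_of_mem_iSup {κ : Sort*} (N : κ → Submodule ℤ (ι → ℤ))
    (W : κ → Submodule ℝ (ι → ℝ)) (h : ∀ j, ∀ b ∈ N j, intVec b ∈ W j) {b : ι → ℤ}
    (hb : b ∈ ⨆ j, N j) : intVec b ∈ ⨆ j, W j := by
  refine Submodule.iSup_induction N (motive := fun b ↦ intVec b ∈ ⨆ j, W j) hb
    (fun j b hb ↦ mem_iSup_of_mem j (h j b hb)) ?_ fun x y hx hy ↦ ?_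
  · rw [intVec_zero₂]; exact zero_mem _
  · rw [intVec_add₂]; exact add_mem hx hy

/-- `sublatticeSpan` commutes with suprema. [cite: Lange2023AbelianVarietiesComplex, §1.1.6 Exercise (2)(a), p. 26] -/
theorem sublatticeSpan_iSup {κ : Sort*} (N : κ → Submodule ℤ (ι → ℤ)) :
    sublatticeSpan (⨆ j, N j) = ⨆ j, sublatticeSpan (N j) := by
  refine le_antisymm ?_ (iSup_le fun j ↦ sublatticeSpan_mono (le_iSup N j))
  rw [sublatticeSpan, span_le]
  rintro _ ⟨b, hb, rfl⟩
  exact intVec_mem_iSup_of_mem_iSup N _ (fun j b hb ↦ intVec_mem_sublatticeSpan hb) hb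

/-- `sublatticeSpan (N ⊔ N') = sublatticeSpan N ⊔ sublatticeSpan N'`. [cite: Lange2023AbelianVarietiesComplex, §1.1.6 Exercise (2)(a), p. 26] -/
theorem sublatticeSpan_sup (N N' : Submodule ℤ (ι → ℤ)) : sublatticeSpan (N ⊔ N') = sublatticeSpan N ⊔ sublatticeSpan N' := by
  rw [sup_eq_iSup, sup_eq_iSup, sublatticeSpan_iSup]
  congr 1
  funext b
  cases b <;> rfl

/-- `sublatticeSpan ⊤ = ⊤` (`Λ` spans `Λ ⊗ ℝ`). [cite: LangeBirkenhake1992, Exercise 1.1.6 (2)(a)] -/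
theorem sublatticeSpan_top [Fintype ι] [DecidableEq ι] : sublatticeSpan (⊤ : Submodule ℤ (ι → ℤ)) = ⊤ := by
  rw [← subLattice_top (ι := ι), sublatticeSpan_subLattice isLatticeSubspace_top]

variable {Φ η}

/-- **`η`-orthogonal complex subspaces have `H`-orthogonal lattices**: if `Φ(V)` is a complex subspace
and `η(ΦV, ΦW) = 0`, then `H(Λ ∩ V, Λ ∩ W) = 0` (as `H(v, w) = η(iv, w) + iη(v, w)` and `iv ∈ ΦV`).
[cite: Lange2023AbelianVarietiesComplex, §2.4.4 Cor. 2.4.24 (the induced polarization splits), p. 123] -/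
theorem isOrtho_subLattice {V W : Submodule ℝ (ι → ℝ)} (hVc : IsComplexSubspace Φ V)
    (h : ∀ v ∈ V, ∀ w ∈ W, η ![Φ v, Φ w] = 0) :
    IndecomposableSplitting.IsOrtho (hermFormZ Φ η) (subLattice V) (subLattice W) := by
  intro m hm n hn
  rw [mem_subLattice_iff] at hm hn
  rw [hermFormZ_eq_zero_iff]
  refine ⟨?_, h _ hm _ hn⟩
  have := h _ (hVc _ hm) _ hn
  rwa [ContinuousLinearEquiv.apply_symm_apply] at this

/-- **`H`-orthogonal sublattices have `E`-orthogonal real spans.**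
[cite: Lange2023AbelianVarietiesComplex, §1.2.2 Lemma 1.2.10 (`E = Im H`)] -/
theorem orthogonal_sublatticeSpan {N₁ N₂ : Submodule ℤ (ι → ℤ)}
    (h : IndecomposableSplitting.IsOrtho (hermFormZ Φ η) N₁ N₂) :
    ∀ v ∈ sublatticeSpan N₁, ∀ w ∈ sublatticeSpan N₂, η ![Φ v, Φ w] = 0 := by
  have key : IndecomposableSplitting.IsOrtho (imBilin Φ η) (sublatticeSpan N₁) (sublatticeSpan N₂) := by
    refine IndecomposableSplitting.isOrtho_span_span (imBilin Φ η) (imBilin_symm_zero Φ η) ?_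
    rintro _ ⟨m, hm, rfl⟩ _ ⟨n, hn, rfl⟩
    exact ((hermFormZ_eq_zero_iff Φ η m n).1 (h m hm n hn)).2
  intro v hv w hw
  exact key v hv w hw

/-- **`H`-orthogonal sublattices have `Re H`-orthogonal real spans** (for `η` of type `(1,1)`).
[cite: Lange2023AbelianVarietiesComplex, §1.2.2 Lemma 1.2.10 (`Re H`)] -/
theorem hodgeBilin_sublatticeSpan (h11 : ∀ u v : E, η ![I • u, I • v] = η ![u, v]) {N₁ N₂ : Submodule ℤ (ι → ℤ)}
    (h : IndecomposableSplitting.IsOrtho (hermFormZ Φ η) N₁ N₂) :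
    IndecomposableSplitting.IsOrtho (hodgeBilin Φ η) (sublatticeSpan N₁) (sublatticeSpan N₂) := by
  refine IndecomposableSplitting.isOrtho_span_span (hodgeBilin Φ η) (hodgeBilin_symm_zero h11) ?_
  rintro _ ⟨m, hm, rfl⟩ _ ⟨n, hn, rfl⟩
  exact ((hermFormZ_eq_zero_iff Φ η m n).1 (h m hm n hn)).1

/-- **Orthogonal complements for `Re H`**: if `P = V ⊔ W` with `Re H(V, W) = 0` and `y ∈ P` is
`Re H`-orthogonal to `W`, then `y ∈ V` (write `y = a + u`; then `Re H(u, u) = Re H(y, u) - Re H(a, u) = 0`).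
[cite: Lange2023AbelianVarietiesComplex, §1.2.2 Lemma 1.2.10 (positive definite)] -/
theorem IsRiemannForm.mem_of_sup_eq_of_orthogonal (hη : IsRiemannForm Φ η) {P V W : Submodule ℝ (ι → ℝ)}
    (hVW : IndecomposableSplitting.IsOrtho (hodgeBilin Φ η) V W) (hsup : V ⊔ W = P) {y : ι → ℝ}
    (hy : y ∈ P) (hyW : ∀ u ∈ W, hodgeBilin Φ η y u = 0) : y ∈ V := by
  rw [← hsup] at hy
  obtain ⟨a, ha, u, hu, rfl⟩ := mem_sup.1 hy
  have h1 : hodgeBilin Φ η (a + u) u = 0 := hyW u hu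
  have h2 : hodgeBilin Φ η a u = 0 := hVW a ha u hu
  have h3 : hodgeBilin Φ η u u = 0 := by
    rw [map_add, LinearMap.add_apply, h2, zero_add] at h1
    exact h1
  rw [hη.eq_zero_of_hodgeBilin_self h3, add_zero]
  exact ha

/-- **The summands of an `H`-orthogonal splitting of a complex lattice subspace are complex**: if `Φ(P)`
is a complex subspace, `P = V ⊔ W` with `V, W` the real spans of `H`-orthogonal sublattices, then `Φ(V)` is
a complex subspace (for `x ∈ V`, `Jx ∈ P` is `Re H`-orthogonal to `W` since `Re H(Jx, w) = -E(x, w) = 0`).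
[cite: Debarre1996PolarisationsProduits, Théorème 1 (the factors `Xᵢ ∩ Yⱼ` are abelian subvarieties)] -/
theorem IsRiemannForm.isComplexSubspace_of_sup_eq (hη : IsRiemannForm Φ η) {P : Submodule ℝ (ι → ℝ)}
    (hPc : IsComplexSubspace Φ P) {N₁ N₂ : Submodule ℤ (ι → ℤ)}
    (h : IndecomposableSplitting.IsOrtho (hermFormZ Φ η) N₁ N₂) (hsup : sublatticeSpan N₁ ⊔ sublatticeSpan N₂ = P) :
    IsComplexSubspace Φ (sublatticeSpan N₁) := by
  intro x hx
  have hxP : x ∈ P := hsup ▸ mem_sup_left hx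
  refine hη.mem_of_sup_eq_of_orthogonal (hodgeBilin_sublatticeSpan hη.1 h) hsup (hPc x hxP) fun u hu ↦ ?_
  rw [hodgeBilin_J, imBilin_apply, orthogonal_sublatticeSpan h x hx u hu, neg_zero]

/-- The real spans of pairwise `H`-orthogonal sublattices are independent over `ℝ` (`Re H` is positive
definite). [cite: Lange2023AbelianVarietiesComplex, §1.2.2 Lemma 1.2.10 (positive definite)] -/
theorem IsRiemannForm.iSupIndep_sublatticeSpan (hη : IsRiemannForm Φ η) {κ : Type*} {N : κ → Submodule ℤ (ι → ℤ)}
    (h : ∀ i j, i ≠ j → IndecomposableSplitting.IsOrtho (hermFormZ Φ η) (N i) (N j)) :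
    iSupIndep fun i ↦ sublatticeSpan (N i) := by
  intro i
  rw [disjoint_def]
  intro x hx hx'
  have horth : IndecomposableSplitting.IsOrtho (hodgeBilin Φ η) (sublatticeSpan (N i))
      (⨆ (j) (_ : j ≠ i), sublatticeSpan (N j)) :=
    IndecomposableSplitting.isOrtho_iSup_right _ fun j ↦
      IndecomposableSplitting.isOrtho_iSup_right _ fun (hj : j ≠ i) ↦
        hodgeBilin_sublatticeSpan hη.1 (h i j (Ne.symm hj))
  exact hη.eq_zero_of_hodgeBilin_self (horth x hx x hx')

end RealSpan

/-! ### § 3 Product families, product pairs inside a subvariety, indecomposable subvarieties -/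

section Defs

variable (Φ : (ι → ℝ) ≃L[ℝ] E) (η : E [⋀^Fin 2]→L[ℝ] ℝ)

/-- **An `r`-fold product decomposition `(X, η) = ∏ᵢ (Xᵢ, η|Xᵢ)` into polarised abelian subvarieties**
(internal form, indexed by `κ`): complex lattice subspaces `Vᵢ ⊆ Λ ⊗ ℝ` (the `Xᵢ`), pairwise
`η`-orthogonal ("the polarizations split"), independent, and splitting the LATTICE: `Λ = ⊕ᵢ (Λ ∩ Vᵢ)` — for
`r = 2` exactly g13-#1's `IsProductPair` (`IsProductPair.isProductFamily` / `IsProductFamily.isProductPair`); zero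
factors allowed.
[cite: Debarre1996PolarisationsProduits, Corollaire 2 ("`(X, θ) = ∏ᵢ₌₁ʳ (Xᵢ, θ|Xᵢ)`", erratum)]
[cite: Lange2023AbelianVarietiesComplex, §2.4.4 Cor. 2.4.24 and Cor. 2.4.31, pp. 123, 125] -/
structure IsProductFamily {κ : Type*} (V : κ → Submodule ℝ (ι → ℝ)) : Prop where
  /-- Each `Vᵢ` is a lattice subspace. -/
  isLatticeSubspace : ∀ i, IsLatticeSubspace (V i)
  /-- Each `Φ(Vᵢ)` is a complex subspace. -/
  isComplexSubspace : ∀ i, IsComplexSubspace Φ (V i)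
  /-- The factors are pairwise `η`-orthogonal. -/
  orthogonal : ∀ i j, i ≠ j → ∀ v ∈ V i, ∀ w ∈ V j, η ![Φ v, Φ w] = 0
  /-- The factors are independent (the sum `Σ Vᵢ` is direct). -/
  iSupIndep : iSupIndep V
  /-- The lattice splits: `Λ = Σᵢ (Λ ∩ Vᵢ)`. -/
  iSup_subLattice : ⨆ i, subLattice (V i) = ⊤

/-- **A product decomposition `(X_U, η|U) = (Y, η|Y) × (Z, η|Z)` OF THE POLARISED ABELIAN SUBVARIETY on
the complex lattice subspace `U`**: a pair `(V, W)` of complex lattice subspaces with `V ⊕ W = U`,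
`η(ΦV, ΦW) = 0` and `Λ ∩ U = (Λ ∩ V) ⊕ (Λ ∩ W)`; for `U = Λ ⊗ ℝ` this is `IsProductPair`
(`isProductPairIn_top_iff`). [cite: Debarre1996PolarisationsProduits, Théorème 1 ("`(Xᵢ, θ|Xᵢ) ≃ (Xᵢ ∩ Y₁, θ|…) × (Xᵢ ∩ Y₂, θ|…)`")]
[cite: Lange2023AbelianVarietiesComplex, §2.4.4 Cor. 2.4.31, p. 125] -/
structure IsProductPairIn (U V W : Submodule ℝ (ι → ℝ)) : Prop where
  /-- `V` is a lattice subspace. -/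
  isLatticeSubspace_left : IsLatticeSubspace V
  /-- `Φ(V)` is a complex subspace. -/
  isComplexSubspace_left : IsComplexSubspace Φ V
  /-- `W` is a lattice subspace. -/
  isLatticeSubspace_right : IsLatticeSubspace W
  /-- `Φ(W)` is a complex subspace. -/
  isComplexSubspace_right : IsComplexSubspace Φ W
  /-- `V ∩ W = 0`. -/
  disjoint : Disjoint V W
  /-- `V + W = U`. -/
  sup_eq : V ⊔ W = U
  /-- `η(ΦV, ΦW) = 0`. -/
  orthogonal : ∀ v ∈ V, ∀ w ∈ W, η ![Φ v, Φ w] = 0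
  /-- `Λ ∩ U = (Λ ∩ V) + (Λ ∩ W)`. -/
  sup_subLattice : subLattice V ⊔ subLattice W = subLattice U

/-- **The polarised abelian subvariety on `U` is indecomposable**: "ni nulle, ni isomorphe au produit de
deux variétés abéliennes polarisées non nulles" — `U ≠ 0` is a complex lattice subspace admitting no product
pair `(V, W)` inside with both `V, W ≠ 0`.
[cite: Debarre1996PolarisationsProduits, p. 631 (definition of «indécomposable»)] -/
def IsIndecomposable (U : Submodule ℝ (ι → ℝ)) : Prop :=
  U ≠ ⊥ ∧ IsLatticeSubspace U ∧ IsComplexSubspace Φ U ∧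
    ∀ V W : Submodule ℝ (ι → ℝ), IsProductPairIn Φ η U V W → V = ⊥ ∨ W = ⊥

variable {Φ η}

/-- A product pair inside `Λ ⊗ ℝ` is a product pair of `(X, η)` and conversely.
[cite: Lange2023AbelianVarietiesComplex, §2.4.4 Cor. 2.4.31, p. 125] -/
theorem isProductPairIn_top_iff {V W : Submodule ℝ (ι → ℝ)} :
    IsProductPairIn Φ η ⊤ V W ↔ IsProductPair Φ η V W := by
  constructor
  · intro h
    exact ⟨h.isLatticeSubspace_left, h.isComplexSubspace_left, h.isLatticeSubspace_right,
      h.isComplexSubspace_right, ⟨h.disjoint, codisjoint_iff.2 h.sup_eq⟩, h.orthogonal,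
      by rw [h.sup_subLattice, subLattice_top]⟩
  · intro h
    exact ⟨h.isLatticeSubspace_left, h.isComplexSubspace_left, h.isLatticeSubspace_right,
      h.isComplexSubspace_right, h.isCompl.disjoint, codisjoint_iff.1 h.isCompl.codisjoint, h.orthogonal,
      by rw [h.sup_subLattice, subLattice_top]⟩

/-- **`(X, η)` is indecomposable iff it is not decomposable** in the sense of g13-#1
(`IsPolarizedDecomposable`), for `X ≠ 0`. [cite: Debarre1996PolarisationsProduits, p. 631 (definition of «indécomposable»)] -/
theorem isIndecomposable_top_iff [Fintype ι] [DecidableEq ι] [Nonempty ι] :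
    IsIndecomposable Φ η ⊤ ↔ ¬ IsPolarizedDecomposable Φ η := by
  constructor
  · rintro ⟨-, -, -, h⟩ ⟨V, W, hV, hW, hp⟩
    rcases h V W (isProductPairIn_top_iff.2 hp) with h0 | h0
    · exact hV h0
    · exact hW h0
  · intro h
    refine ⟨?_, isLatticeSubspace_top, isComplexSubspace_top Φ, fun V W hp ↦ ?_⟩
    · obtain ⟨i⟩ := ‹Nonempty ι›
      intro htop
      have : (Pi.single i (1 : ℝ) : ι → ℝ) ∈ (⊤ : Submodule ℝ (ι → ℝ)) := mem_top
      rw [htop, mem_bot] at this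
      exact (one_ne_zero (α := ℝ)) (by simpa using congrFun this i)
    · by_contra hne
      push Not at hne
      exact h ⟨V, W, hne.1, hne.2, isProductPairIn_top_iff.1 hp⟩

/-- A product pair `(V, W)` is the product family `(V, W)` indexed by `Bool`.
[cite: Lange2023AbelianVarietiesComplex, §2.4.4 Cor. 2.4.31, p. 125] -/
theorem IsProductPair.isProductFamily {V W : Submodule ℝ (ι → ℝ)} (hp : IsProductPair Φ η V W) :
    IsProductFamily Φ η (fun b : Bool ↦ cond b V W) where
  isLatticeSubspace b := by cases b <;> [exact hp.isLatticeSubspace_right; exact hp.isLatticeSubspace_left]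
  isComplexSubspace b := by cases b <;> [exact hp.isComplexSubspace_right; exact hp.isComplexSubspace_left]
  orthogonal b b' hne v hv w hw := by
    cases b <;> cases b' <;> simp only [ne_eq, not_true_eq_false] at hne
    · simp only [cond_false, cond_true] at hv hw
      rw [twoForm_swap, hp.orthogonal w hw v hv, neg_zero]
    · simp only [cond_false, cond_true] at hv hw
      exact hp.orthogonal v hv w hw
  iSupIndep := by
    rw [iSupIndep_def]
    intro b
    cases b
    · have : (⨆ (j : Bool) (_ : j ≠ false), cond j V W) = V := by
        rw [iSup_bool_eq]; simp
      rw [this]; exact hp.isCompl.disjoint.symm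
    · have : (⨆ (j : Bool) (_ : j ≠ true), cond j V W) = W := by
        rw [iSup_bool_eq]; simp
      rw [this]; exact hp.isCompl.disjoint
  iSup_subLattice := by
    rw [iSup_bool_eq]
    simpa [sup_comm] using hp.sup_subLattice

/-- The factors of a product family span `Λ ⊗ ℝ`: `⨆ᵢ Vᵢ = ⊤` (as `Λ = Σᵢ (Λ ∩ Vᵢ)` spans).
[cite: Lange2023AbelianVarietiesComplex, §2.4.4 Cor. 2.4.24 (complementary abelian subvarieties), p. 123] -/
theorem IsProductFamily.iSup_eq_top [Fintype ι] [DecidableEq ι] {κ : Type*} {V : κ → Submodule ℝ (ι → ℝ)}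
    (hV : IsProductFamily Φ η V) : ⨆ i, V i = ⊤ := by
  rw [eq_top_iff, ← sublatticeSpan_top (ι := ι), ← hV.iSup_subLattice, sublatticeSpan_iSup]
  exact iSup_mono fun i ↦ (sublatticeSpan_subLattice (hV.isLatticeSubspace i)).le

/-- A product family indexed by `Bool` is a product pair.
[cite: Lange2023AbelianVarietiesComplex, §2.4.4 Cor. 2.4.31, p. 125] -/
theorem IsProductFamily.isProductPair [Fintype ι] [DecidableEq ι] {V W : Submodule ℝ (ι → ℝ)}
    (h : IsProductFamily Φ η (fun b : Bool ↦ cond b V W)) : IsProductPair Φ η V W where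
  isLatticeSubspace_left := h.isLatticeSubspace true
  isComplexSubspace_left := h.isComplexSubspace true
  isLatticeSubspace_right := h.isLatticeSubspace false
  isComplexSubspace_right := h.isComplexSubspace false
  isCompl := by
    refine ⟨?_, codisjoint_iff.2 ?_⟩
    · have hd := h.iSupIndep true
      have : (⨆ (j : Bool) (_ : j ≠ true), cond j V W) = W := by rw [iSup_bool_eq]; simp
      rw [this] at hd
      exact hd
    · have := h.iSup_eq_top
      rwa [iSup_bool_eq] at this
  orthogonal := h.orthogonal true false (by decide)
  sup_subLattice := by
    have := h.iSup_subLattice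
    rwa [iSup_bool_eq] at this

end Defs

/-! ### § 4 The dictionary with the definite hermitian lattice `(Λ, H)` (FILE 1) -/

section Dictionary

variable {Φ : (ι → ℝ) ≃L[ℝ] E} {η : E [⋀^Fin 2]→L[ℝ] ℝ} {κ : Type*}

/-- **A product family of `(X, η)` is an `H`-orthogonal splitting `Λ = ⊥ᵢ (Λ ∩ Vᵢ)` of the lattice.**
[cite: Debarre1996PolarisationsProduits, Corollaire 2 (setting)] -/
theorem IsProductFamily.isOrthogonalDecomposition {V : κ → Submodule ℝ (ι → ℝ)} (hV : IsProductFamily Φ η V) :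
    IndecomposableSplitting.IsOrthogonalDecomposition (hermFormZ Φ η) (fun i ↦ subLattice (V i)) where
  isOrtho i j hne := isOrtho_subLattice (hV.isComplexSubspace i) (hV.orthogonal i j hne)
  iSup_eq_top := hV.iSup_subLattice

/-- The members of a product family are recovered from their lattices: `Vᵢ = (Λ ∩ Vᵢ) ⊗ ℝ`.
[cite: LangeBirkenhake1992, Exercise 1.1.6 (2)(a)] -/
theorem IsProductFamily.sublatticeSpan_subLattice {V : κ → Submodule ℝ (ι → ℝ)} (hV : IsProductFamily Φ η V) (i : κ) :
    sublatticeSpan (subLattice (V i)) = V i :=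
  ComplexTorus.sublatticeSpan_subLattice (hV.isLatticeSubspace i)

/-- **An `H`-orthogonal splitting `Λ = ⊥ᵢ Nᵢ` of the lattice is a product family `(X, η) = ∏ᵢ (Xᵢ, η|Xᵢ)`**
with `Xᵢ` the sub-torus on `Nᵢ ⊗ ℝ` — in particular the `Nᵢ ⊗ ℝ` are COMPLEX subspaces.
[cite: Debarre1996PolarisationsProduits, Théorème 1 and Corollaire 2] -/
theorem IsRiemannForm.isProductFamily_sublatticeSpan [Fintype ι] [DecidableEq ι] (hη : IsRiemannForm Φ η)
    {N : κ → Submodule ℤ (ι → ℤ)}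
    (hN : IndecomposableSplitting.IsOrthogonalDecomposition (hermFormZ Φ η) N) :
    IsProductFamily Φ η (fun i ↦ sublatticeSpan (N i)) where
  isLatticeSubspace i := isLatticeSubspace_sublatticeSpan (N i)
  isComplexSubspace i := by
    have hsplit : (⨆ j, N j) = N i ⊔ ⨆ (j) (_ : j ≠ i), N j := iSup_split_single N i
    have horth : IndecomposableSplitting.IsOrtho (hermFormZ Φ η) (N i) (⨆ (j) (_ : j ≠ i), N j) :=
      IndecomposableSplitting.isOrtho_iSup_right _ fun j ↦
        IndecomposableSplitting.isOrtho_iSup_right _ fun (hj : j ≠ i) ↦ hN.isOrtho i j (Ne.symm hj)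
    refine hη.isComplexSubspace_of_sup_eq (isComplexSubspace_top Φ) horth ?_
    rw [← sublatticeSpan_sup, ← hsplit, hN.iSup_eq_top, sublatticeSpan_top]
  orthogonal i j hne := orthogonal_sublatticeSpan (hN.isOrtho i j hne)
  iSupIndep := hη.iSupIndep_sublatticeSpan hN.isOrtho
  iSup_subLattice := by
    rw [eq_top_iff, ← hN.iSup_eq_top]
    exact iSup_mono fun i ↦ le_subLattice_sublatticeSpan (N i)

/-- **The summands of an `H`-orthogonal splitting of `Λ` are saturated**: `Λ ∩ (Nᵢ ⊗ ℝ) = Nᵢ`.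
[cite: Debarre1996PolarisationsProduits, Corollaire 2 (the `Xᵢ` are abelian subvarieties with `X = ∏ Xᵢ`)] -/
theorem IsRiemannForm.subLattice_sublatticeSpan_eq (hη : IsRiemannForm Φ η) {N : κ → Submodule ℤ (ι → ℤ)}
    (hN : IndecomposableSplitting.IsOrthogonalDecomposition (hermFormZ Φ η) N) (i : κ) :
    subLattice (sublatticeSpan (N i)) = N i := by
  refine le_antisymm ?_ (le_subLattice_sublatticeSpan (N i))
  intro m hm
  rw [mem_subLattice_iff] at hm
  have hmtop : m ∈ (⨆ j, N j) := hN.iSup_eq_top ▸ mem_top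
  rw [iSup_split_single N i] at hmtop
  obtain ⟨a, ha, b, hb, rfl⟩ := mem_sup.1 hmtop
  have hbW : intVec b ∈ ⨆ (j) (_ : j ≠ i), sublatticeSpan (N j) :=
    intVec_mem_iSup_of_mem_iSup (fun j ↦ ⨆ (_ : j ≠ i), N j) (fun j ↦ ⨆ (_ : j ≠ i), sublatticeSpan (N j))
      (fun j b hb ↦ intVec_mem_iSup_of_mem_iSup (fun _ : j ≠ i ↦ N j) (fun _ ↦ sublatticeSpan (N j))
        (fun _ b hb ↦ intVec_mem_sublatticeSpan hb) hb) hb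
  have hbV : intVec b ∈ sublatticeSpan (N i) := by
    have : intVec b = intVec (a + b) - intVec a := by rw [intVec_add₂, add_sub_cancel_left]
    rw [this]
    exact sub_mem hm (intVec_mem_sublatticeSpan ha)
  have hb0 : intVec b = 0 := by
    have hdisj := hη.iSupIndep_sublatticeSpan hN.isOrtho i
    rw [disjoint_def] at hdisj
    exact hdisj _ hbV hbW
  rw [(intVec_eq_zero_iff₂ b).1 hb0, add_zero]
  exact ha

/-- **An indecomposable polarised abelian subvariety has an indecomposable lattice** `(Λ ∩ U, H)`.
[cite: Debarre1996PolarisationsProduits, Corollaire 2 b) (hypothesis «indécomposables»)] -/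
theorem IsIndecomposable.subLattice (hη : IsRiemannForm Φ η) {U : Submodule ℝ (ι → ℝ)}
    (hU : IsIndecomposable Φ η U) :
    IndecomposableSplitting.IsIndecomposable (hermFormZ Φ η) (subLattice U) := by
  obtain ⟨hU0, hUl, hUc, hind⟩ := hU
  refine ⟨fun h ↦ hU0 ?_, fun N₁ N₂ horth hsup ↦ ?_⟩
  · rw [← sublatticeSpan_subLattice hUl, h, sublatticeSpan_eq_bot_iff]
  have hsupR : sublatticeSpan N₁ ⊔ sublatticeSpan N₂ = U := by rw [← sublatticeSpan_sup, hsup, sublatticeSpan_subLattice hUl]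
  have hp : IsProductPairIn Φ η U (sublatticeSpan N₁) (sublatticeSpan N₂) :=
    { isLatticeSubspace_left := isLatticeSubspace_sublatticeSpan N₁
      isComplexSubspace_left := hη.isComplexSubspace_of_sup_eq hUc horth hsupR
      isLatticeSubspace_right := isLatticeSubspace_sublatticeSpan N₂
      isComplexSubspace_right :=
        hη.isComplexSubspace_of_sup_eq hUc (horth.symm hη.hermFormZ_symm_zero)
          (by rw [sup_comm, hsupR])
      disjoint := by
        rw [disjoint_def]
        intro x h1 h2
        exact hη.eq_zero_of_hodgeBilin_self (hodgeBilin_sublatticeSpan hη.1 horth x h1 x h2)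
      sup_eq := hsupR
      orthogonal := orthogonal_sublatticeSpan horth
      sup_subLattice := by
        refine le_antisymm (sup_le (subLattice_mono₂ (hsupR ▸ le_sup_left))
          (subLattice_mono₂ (hsupR ▸ le_sup_right))) ?_
        rw [← hsup]
        exact sup_le_sup (le_subLattice_sublatticeSpan N₁) (le_subLattice_sublatticeSpan N₂) }
  rcases hind _ _ hp with h | h
  · left; exact sublatticeSpan_eq_bot_iff.1 h
  · right; exact sublatticeSpan_eq_bot_iff.1 h

/-- A lattice subspace with zero lattice is zero. [cite: LangeBirkenhake1992, Exercise 1.1.6 (2)(a)] -/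
theorem eq_bot_of_subLattice_eq_bot {V : Submodule ℝ (ι → ℝ)} (hV : IsLatticeSubspace V)
    (h : subLattice V = ⊥) : V = ⊥ := by
  rw [← sublatticeSpan_subLattice hV, h, sublatticeSpan_eq_bot_iff]

/-- **Conversely, a complex lattice subspace whose lattice `(Λ ∩ U, H)` is indecomposable carries an
indecomposable polarised abelian subvariety.** [cite: Debarre1996PolarisationsProduits, Corollaire 2 b)] -/
theorem isIndecomposable_of_subLattice {U : Submodule ℝ (ι → ℝ)} (hUl : IsLatticeSubspace U)
    (hUc : IsComplexSubspace Φ U)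
    (h : IndecomposableSplitting.IsIndecomposable (hermFormZ Φ η) (subLattice U)) : IsIndecomposable Φ η U := by
  refine ⟨fun hU0 ↦ h.1 ?_, hUl, hUc, fun V W hp ↦ ?_⟩
  · rw [hU0, eq_bot_iff]
    intro m hm
    rw [mem_subLattice_iff, mem_bot] at hm
    exact (mem_bot ℤ).2 ((intVec_eq_zero_iff₂ m).1 hm)
  · rcases h.2 _ _ (isOrtho_subLattice hp.isComplexSubspace_left hp.orthogonal) hp.sup_subLattice with h0 | h0
    · exact Or.inl (eq_bot_of_subLattice_eq_bot hp.isLatticeSubspace_left h0)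
    · exact Or.inr (eq_bot_of_subLattice_eq_bot hp.isLatticeSubspace_right h0)

/-- **Dictionary for indecomposability**: `(X_U, η|U)` is indecomposable iff `U` is a complex lattice
subspace whose hermitian lattice `(Λ ∩ U, H)` is indecomposable in the sense of O'Meara § 105.
[cite: Debarre1996PolarisationsProduits, Corollaire 2 b)] [cite: Omeara1963, § 105 (definition), p. 321] -/
theorem isIndecomposable_iff (hη : IsRiemannForm Φ η) {U : Submodule ℝ (ι → ℝ)} :
    IsIndecomposable Φ η U ↔ IsLatticeSubspace U ∧ IsComplexSubspace Φ U ∧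
      IndecomposableSplitting.IsIndecomposable (hermFormZ Φ η) (subLattice U) :=
  ⟨fun h ↦ ⟨h.2.1, h.2.2.1, h.subLattice hη⟩, fun h ↦ isIndecomposable_of_subLattice h.1 h.2.1 h.2.2⟩

end Dictionary

/-! ### § 5 Existence: the indecomposable polarised components -/

section Existence

variable (Φ : (ι → ℝ) ≃L[ℝ] E) (η : E [⋀^Fin 2]→L[ℝ] ℝ)

/-- **The indecomposable polarised components of `(X, η)`**: the real spans `K ⊗ ℝ ⊆ Λ ⊗ ℝ` of the
Eichler–Kneser components `K` of the hermitian lattice `(Λ, H)` (O'Meara's `K₁, …, K_t`) — the tangent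
lattice-spaces of the indecomposable polarised abelian subvarieties whose product is `(X, η)`.
[cite: Debarre1996PolarisationsProduits, p. 631 ("se décompose en produit de sous-variétés abéliennes polarisées indécomposables")]
[cite: Omeara1963, § 105 proof of Thm 105:1 step 3), p. 322] -/
def polarizedComponents : Set (Submodule ℝ (ι → ℝ)) :=
  sublatticeSpan '' IndecomposableSplitting.components (hermFormZ Φ η)

variable {Φ η}

/-- **EXISTENCE — "toute variété abélienne polarisée non nulle se décompose en produit de sous-variétés
abéliennes polarisées indécomposables"**: the polarised components, indexed by the Eichler–Kneser components
of `(Λ, H)`, form a product family of `(X, η)`. [cite: Debarre1996PolarisationsProduits, p. 631] -/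
theorem IsRiemannForm.isProductFamily_components [Fintype ι] [DecidableEq ι] (hη : IsRiemannForm Φ η) :
    IsProductFamily Φ η
      (fun K : IndecomposableSplitting.components (hermFormZ Φ η) ↦ sublatticeSpan (K : Submodule ℤ (ι → ℤ))) :=
  hη.isProductFamily_sublatticeSpan
    (IndecomposableSplitting.isOrthogonalDecomposition_components hη.isDefinite_hermFormZ)

/-- The set of polarised components is the range of that family. [cite: Debarre1996PolarisationsProduits, p. 631] -/
theorem polarizedComponents_eq_range :
    polarizedComponents Φ η = Set.range
      (fun K : IndecomposableSplitting.components (hermFormZ Φ η) ↦ sublatticeSpan (K : Submodule ℤ (ι → ℤ))) := by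
  rw [polarizedComponents, ← image_univ, image_eq_range]
  ext V
  simp

/-- **EXISTENCE, set form**: the polarised components form a product family of `(X, η)` (indexed by
themselves). [cite: Debarre1996PolarisationsProduits, p. 631] -/
theorem IsRiemannForm.isProductFamily_polarizedComponents [Fintype ι] [DecidableEq ι] (hη : IsRiemannForm Φ η) :
    IsProductFamily Φ η (fun V : polarizedComponents Φ η ↦ (V : Submodule ℝ (ι → ℝ))) := by
  have hF := hη.isProductFamily_components
  have hmem : ∀ V : polarizedComponents Φ η, ∃ K : IndecomposableSplitting.components (hermFormZ Φ η),
      sublatticeSpan (K : Submodule ℤ (ι → ℤ)) = V := fun V ↦ by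
    obtain ⟨K, hK, hKV⟩ := V.2
    exact ⟨⟨K, hK⟩, hKV⟩
  choose g hg using hmem
  have hginj : Injective g := fun V V' h ↦ Subtype.ext (by rw [← hg V, ← hg V', h])
  refine ⟨fun V ↦ hg V ▸ hF.isLatticeSubspace (g V), fun V ↦ hg V ▸ hF.isComplexSubspace (g V),
    fun V V' hne ↦ ?_, ?_, ?_⟩
  · rw [← hg V, ← hg V']
    exact hF.orthogonal (g V) (g V') (fun h ↦ hne (hginj h))
  · have := hF.iSupIndep.comp hginj
    convert this using 1
    funext V
    exact (hg V).symm
  · rw [eq_top_iff, ← hF.iSup_subLattice]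
    refine iSup_le fun K ↦ ?_
    have hKmem : sublatticeSpan (K : Submodule ℤ (ι → ℤ)) ∈ polarizedComponents Φ η := ⟨K, K.2, rfl⟩
    exact le_iSup_of_le ⟨_, hKmem⟩ le_rfl

/-- **The polarised components are indecomposable polarised abelian subvarieties.**
[cite: Debarre1996PolarisationsProduits, p. 631] [cite: Omeara1963, § 105 (the `Kⱼ` are indecomposable), p. 322] -/
theorem IsRiemannForm.isIndecomposable_of_mem_polarizedComponents [Fintype ι] [DecidableEq ι] (hη : IsRiemannForm Φ η)
    {V : Submodule ℝ (ι → ℝ)} (hV : V ∈ polarizedComponents Φ η) : IsIndecomposable Φ η V := by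
  obtain ⟨K, hK, rfl⟩ := hV
  have hdec := IndecomposableSplitting.isOrthogonalDecomposition_components hη.isDefinite_hermFormZ
  have hF := hη.isProductFamily_sublatticeSpan hdec
  refine isIndecomposable_of_subLattice (hF.isLatticeSubspace ⟨K, hK⟩) (hF.isComplexSubspace ⟨K, hK⟩) ?_
  rw [hη.subLattice_sublatticeSpan_eq hdec ⟨K, hK⟩]
  exact IndecomposableSplitting.isIndecomposable_of_mem_components hη.isDefinite_hermFormZ hK

/-- The polarised components are non-zero. [cite: Debarre1996PolarisationsProduits, p. 631] -/
theorem IsRiemannForm.ne_bot_of_mem_polarizedComponents [Fintype ι] [DecidableEq ι] (hη : IsRiemannForm Φ η)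
    {V : Submodule ℝ (ι → ℝ)} (hV : V ∈ polarizedComponents Φ η) : V ≠ ⊥ :=
  (hη.isIndecomposable_of_mem_polarizedComponents hV).1

/-- **There are only finitely many polarised components** (they are independent non-zero subspaces of the
finite-dimensional `Λ ⊗ ℝ`). [cite: Debarre1996PolarisationsProduits, Corollaire 2 (finite products `∏ᵢ₌₁ʳ`)] -/
theorem IsRiemannForm.finite_polarizedComponents [Fintype ι] [DecidableEq ι] (hη : IsRiemannForm Φ η) :
    (polarizedComponents Φ η).Finite := by
  have hF := hη.isProductFamily_polarizedComponents
  have hfin := hF.iSupIndep.fintypeNeBotOfFiniteDimensional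
  have hinj : Injective (fun V : polarizedComponents Φ η ↦
      (⟨V, hη.ne_bot_of_mem_polarizedComponents V.2⟩ :
        {V : polarizedComponents Φ η // (V : Submodule ℝ (ι → ℝ)) ≠ ⊥})) :=
    fun V V' h ↦ by simpa using congrArg Subtype.val h
  haveI : Finite (polarizedComponents Φ η) := Finite.of_injective _ hinj
  exact Set.toFinite _

end Existence

/-! ### § 6 Uniqueness: Debarre's Théorème 1 and Corollaire 2 -/

section Uniqueness

variable [Fintype ι] {Φ : (ι → ℝ) ≃L[ℝ] E} {η : E [⋀^Fin 2]→L[ℝ] ℝ} {κ κ' : Type*}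
  {X : κ → Submodule ℝ (ι → ℝ)} {Y : κ' → Submodule ℝ (ι → ℝ)}

/-- **UNIQUENESS (set form): the factors of ANY decomposition of `(X, η)` into indecomposable polarised
abelian subvarieties are exactly the polarised components.**
[cite: Debarre1996PolarisationsProduits, Corollaire 2 b)] [cite: Omeara1963, § 105 Thm 105:1, p. 321] -/
theorem IsProductFamily.range_eq_polarizedComponents (hX : IsProductFamily Φ η X)
    (hind : ∀ i, IsIndecomposable Φ η (X i)) (hη : IsRiemannForm Φ η) :
    Set.range X = polarizedComponents Φ η := by
  have hN := hX.isOrthogonalDecomposition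
  have hrange := hN.range_eq_components hη.isDefinite_hermFormZ fun i ↦ (hind i).subLattice hη
  rw [polarizedComponents, ← hrange, ← range_comp]
  congr 1
  funext i
  exact (hX.sublatticeSpan_subLattice i).symm

/-- The factors of a decomposition into indecomposables are pairwise distinct.
[cite: Debarre1996PolarisationsProduits, Corollaire 2 b)] -/
theorem IsProductFamily.injective (hX : IsProductFamily Φ η X) (hind : ∀ i, IsIndecomposable Φ η (X i))
    (hη : IsRiemannForm Φ η) : Injective X := by
  intro i j hij
  have hN := hX.isOrthogonalDecomposition
  exact hN.injective hη.isDefinite_hermFormZ (fun i ↦ (hind i).subLattice hη) (by simp only [hij])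

/-- **Debarre 1996, Corollaire 2 b): "Si `(X₁, θ|X₁), …, (X_r, θ|X_r)` et `(Y₁, θ|Y₁), …, (Y_s, θ|Y_s)` sont
indécomposables, on a `r = s` et il existe une permutation `σ` de `{1, …, s}` telle que `Yⱼ = X_{σ(j)}` pour
tout `j`"** — two decompositions of `(X, η)` into indecomposable polarised abelian subvarieties, indexed by
`κ` and `κ'`, agree up to a bijection `κ ≃ κ'`. [cite: Debarre1996PolarisationsProduits, Corollaire 2 b)] -/
theorem debarre1996_corollaire_2b (hX : IsProductFamily Φ η X) (hY : IsProductFamily Φ η Y)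
    (hXind : ∀ i, IsIndecomposable Φ η (X i)) (hYind : ∀ j, IsIndecomposable Φ η (Y j))
    (hη : IsRiemannForm Φ η) : ∃ e : κ ≃ κ', ∀ i, Y (e i) = X i := by
  obtain ⟨e, he⟩ := hX.isOrthogonalDecomposition.exists_equiv hY.isOrthogonalDecomposition
    hη.isDefinite_hermFormZ (fun i ↦ (hXind i).subLattice hη) (fun j ↦ (hYind j).subLattice hη)
  refine ⟨e, fun i ↦ ?_⟩
  rw [← hY.sublatticeSpan_subLattice (e i), ← hX.sublatticeSpan_subLattice i, he i]

/-- **Debarre 1996, Corollaire 2 a): "Si `(X₁, θ|X₁), …, (X_r, θ|X_r)` sont indécomposables, il existe une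
partition `I₁ ⊔ … ⊔ I_s` de `{1, …, r}` telle que `(Yⱼ, θ|Yⱼ) = ∏_{i ∈ Iⱼ} (Xᵢ, θ|Xᵢ)` pour tout `j`"** —
with `Iⱼ = f⁻¹(j)` for a map `f : κ → κ'`: `Yⱼ = ⊕_{f i = j} Xᵢ`.
[cite: Debarre1996PolarisationsProduits, Corollaire 2 a)] -/
theorem debarre1996_corollaire_2a (hX : IsProductFamily Φ η X) (hY : IsProductFamily Φ η Y)
    (hXind : ∀ i, IsIndecomposable Φ η (X i)) (hη : IsRiemannForm Φ η) :
    ∃ f : κ → κ', ∀ j, Y j = ⨆ (i) (_ : f i = j), X i := by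
  obtain ⟨f, hf⟩ := hX.isOrthogonalDecomposition.exists_fiber hη.isDefinite_hermFormZ
    (fun i ↦ (hXind i).subLattice hη) hY.isOrthogonalDecomposition
  refine ⟨f, fun j ↦ ?_⟩
  rw [← hY.sublatticeSpan_subLattice j, hf j, sublatticeSpan_iSup]
  congr 1
  funext i
  rw [sublatticeSpan_iSup, hX.sublatticeSpan_subLattice i]

/-- The partition in Corollaire 2 a) is determined by containment: `Xᵢ ≤ Y_{f i}`.
[cite: Debarre1996PolarisationsProduits, Corollaire 2 a)] -/
theorem debarre1996_corollaire_2a_le (hX : IsProductFamily Φ η X) (hY : IsProductFamily Φ η Y)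
    (hXind : ∀ i, IsIndecomposable Φ η (X i)) (hη : IsRiemannForm Φ η) :
    ∃ f : κ → κ', ∀ i, X i ≤ Y (f i) := by
  obtain ⟨f, hf⟩ := debarre1996_corollaire_2a hX hY hXind hη
  exact ⟨f, fun i ↦ (hf (f i)).symm ▸ le_iSup₂ (f := fun i' (_ : f i' = f i) ↦ X i') i rfl⟩

/-- Exchange at lattice-space level: every factor of one product decomposition is the sum of its
intersections with the factors of any other, `Xᵢ = ⊕ⱼ (Xᵢ ∩ Yⱼ)`.
[cite: Debarre1996PolarisationsProduits, Théorème 1] -/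
theorem IsProductFamily.eq_iSup_inf (hX : IsProductFamily Φ η X) (hY : IsProductFamily Φ η Y)
    (hη : IsRiemannForm Φ η) (i : κ) : X i = ⨆ j, X i ⊓ Y j := by
  have h := hX.isOrthogonalDecomposition.eq_iSup_inf hY.isOrthogonalDecomposition hη.isDefinite_hermFormZ i
  have h' : sublatticeSpan (subLattice (X i)) = sublatticeSpan (⨆ j, subLattice (X i) ⊓ subLattice (Y j)) :=
    congrArg sublatticeSpan h
  rw [hX.sublatticeSpan_subLattice i, sublatticeSpan_iSup] at h'
  refine le_antisymm (h'.le.trans (iSup_mono fun j ↦ ?_)) (iSup_le fun j ↦ inf_le_left)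
  rw [← subLattice_inf₂, sublatticeSpan, span_le]
  rintro _ ⟨m, hm, rfl⟩
  exact hm

/-- The pieces `Xᵢ ∩ Yⱼ` of the exchange are spanned by their lattice points (they are lattice subspaces):
`Xᵢ ∩ Yⱼ = (Λ ∩ Xᵢ ∩ Yⱼ) ⊗ ℝ`. [cite: Debarre1996PolarisationsProduits, Théorème 1 (the `(Xᵢ ∩ Yⱼ)⁰` are abelian subvarieties)] -/
theorem IsProductFamily.sublatticeSpan_subLattice_inf (hX : IsProductFamily Φ η X) (hY : IsProductFamily Φ η Y)
    (hη : IsRiemannForm Φ η) (i : κ) (j : κ') : sublatticeSpan (subLattice (X i ⊓ Y j)) = X i ⊓ Y j := by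
  -- `P j' := (Λ ∩ Xᵢ ∩ Y_{j'}) ⊗ ℝ ≤ Xᵢ ⊓ Y_{j'}`, `⨆ P = Xᵢ`; modular law.
  set P : κ' → Submodule ℝ (ι → ℝ) := fun j' ↦ sublatticeSpan (subLattice (X i ⊓ Y j')) with hP_def
  have hPle : ∀ j', P j' ≤ X i ⊓ Y j' := fun j' ↦ by
    rw [hP_def]
    dsimp only
    rw [sublatticeSpan, span_le]
    rintro _ ⟨m, hm, rfl⟩
    exact hm
  have hsup : ⨆ j', P j' = X i := by
    have h := hX.isOrthogonalDecomposition.eq_iSup_inf hY.isOrthogonalDecomposition hη.isDefinite_hermFormZ i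
    have h' := congrArg sublatticeSpan h
    rw [hX.sublatticeSpan_subLattice i, sublatticeSpan_iSup] at h'
    have hP' : ∀ j', P j' = sublatticeSpan (subLattice (X i) ⊓ subLattice (Y j')) := fun j' ↦ by
      simp only [hP_def, subLattice_inf₂]
    calc ⨆ j', P j' = ⨆ j', sublatticeSpan (subLattice (X i) ⊓ subLattice (Y j')) := iSup_congr hP'
      _ = X i := h'.symm
  -- the other pieces lie in `⨆_{j' ≠ j} Y j'`, which meets `Y j` trivially
  have hrest : (⨆ (j') (_ : j' ≠ j), P j') ≤ ⨆ (j') (_ : j' ≠ j), Y j' :=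
    iSup₂_mono fun j' _ ↦ (hPle j').trans inf_le_right
  have hdisj : Disjoint (⨆ (j') (_ : j' ≠ j), P j') (X i ⊓ Y j) :=
    ((hY.iSupIndep j).symm.mono_left hrest).mono_right inf_le_right
  refine le_antisymm (hPle j) (le_of_eq ?_)
  symm
  calc P j = P j ⊔ (⨆ (j') (_ : j' ≠ j), P j') ⊓ (X i ⊓ Y j) := by rw [hdisj.eq_bot, sup_bot_eq]
    _ = (P j ⊔ ⨆ (j') (_ : j' ≠ j), P j') ⊓ (X i ⊓ Y j) := (sup_inf_assoc_of_le _ (hPle j)).symm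
    _ = (⨆ j', P j') ⊓ (X i ⊓ Y j) := by rw [← iSup_split_single P j]
    _ = X i ⊓ Y j := by rw [hsup]; exact inf_eq_right.2 inf_le_left

/-- **Debarre 1996, Théorème 1: "Soit `(X, θ)` une variété abélienne polarisée contenant des sous-variétés
abéliennes `X₁, X₂, Y₁` et `Y₂` telles que `(X, θ) = (X₁, θ|X₁) × (X₂, θ|X₂) = (Y₁, θ|Y₁) × (Y₂, θ|Y₂)`.
Pour `i = 1, 2`, on a `(Xᵢ, θ|Xᵢ) ≃ (Xᵢ ∩ Y₁, θ|Xᵢ∩Y₁) × (Xᵢ ∩ Y₂, θ|Xᵢ∩Y₂)`"** — here for `i = 1`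
(apply it to `hX.symm` for `i = 2`): `(X₁ ∩ Y₁, X₁ ∩ Y₂)` is a product pair of the polarised abelian
subvariety on `X₁`. [cite: Debarre1996PolarisationsProduits, Théorème 1] -/
theorem debarre1996_theoreme_1 {X₁ X₂ Y₁ Y₂ : Submodule ℝ (ι → ℝ)} (hX : IsProductPair Φ η X₁ X₂)
    (hY : IsProductPair Φ η Y₁ Y₂) (hη : IsRiemannForm Φ η) :
    IsProductPairIn Φ η X₁ (X₁ ⊓ Y₁) (X₁ ⊓ Y₂) := by
  have hXf := hX.isProductFamily
  have hYf := hY.isProductFamily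
  have hspan₁ := hXf.sublatticeSpan_subLattice_inf hYf hη true true
  have hspan₂ := hXf.sublatticeSpan_subLattice_inf hYf hη true false
  simp only [cond_true, cond_false] at hspan₁ hspan₂
  have hsum := hXf.eq_iSup_inf hYf hη true
  simp only [cond_true, iSup_bool_eq, cond_false] at hsum
  refine
    { isLatticeSubspace_left := hspan₁ ▸ isLatticeSubspace_sublatticeSpan _
      isComplexSubspace_left := hX.isComplexSubspace_left.inf hY.isComplexSubspace_left
      isLatticeSubspace_right := hspan₂ ▸ isLatticeSubspace_sublatticeSpan _
      isComplexSubspace_right := hX.isComplexSubspace_left.inf hY.isComplexSubspace_right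
      disjoint := (hY.isCompl.disjoint.mono inf_le_right inf_le_right)
      sup_eq := hsum.symm
      orthogonal := fun v hv w hw ↦ hY.orthogonal v (mem_inf.1 hv).2 w (mem_inf.1 hw).2
      sup_subLattice := ?_ }
  have h := hXf.isOrthogonalDecomposition.eq_iSup_inf hYf.isOrthogonalDecomposition hη.isDefinite_hermFormZ true
  simp only [cond_true, iSup_bool_eq, cond_false] at h
  rw [subLattice_inf₂, subLattice_inf₂]
  exact h.symm

/-- **Existence and uniqueness in one statement**: there is exactly one SET of indecomposable polarised
abelian subvarieties of which `(X, η)` is the product — the polarised components.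
[cite: Debarre1996PolarisationsProduits, p. 631 ("cette décomposition est unique") and Corollaire 2 b)] -/
theorem IsRiemannForm.existsUnique_isProductFamily_isIndecomposable [DecidableEq ι] (hη : IsRiemannForm Φ η) :
    ∃! D : Set (Submodule ℝ (ι → ℝ)),
      IsProductFamily Φ η (fun V : D ↦ (V : Submodule ℝ (ι → ℝ))) ∧ ∀ V ∈ D, IsIndecomposable Φ η V := by
  refine ⟨polarizedComponents Φ η, ⟨hη.isProductFamily_polarizedComponents,
    fun V hV ↦ hη.isIndecomposable_of_mem_polarizedComponents hV⟩, fun D hD ↦ ?_⟩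
  have h := hD.1.range_eq_polarizedComponents (fun V ↦ hD.2 V V.2) hη
  rwa [Subtype.range_coe] at h

end Uniqueness

/-! ### § 7 Validation: elliptic-curve factors, indecomposable tori, product pairs of indecomposables -/

section Validation

variable [Fintype ι] {Φ : (ι → ℝ) ≃L[ℝ] E} {η : E [⋀^Fin 2]→L[ℝ] ℝ}

/-- The real dimension of a non-zero complex lattice subspace is at least `2`.
[cite: Lange2023AbelianVarietiesComplex, §1.1.6 Exercise (2)(a) ("a subgroup `Λ'` of rank `2g'`"), p. 26] -/
theorem two_le_finrank_of_isComplexSubspace {V : Submodule ℝ (ι → ℝ)} (hV : IsLatticeSubspace V)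
    (hVc : IsComplexSubspace Φ V) (hV0 : V ≠ ⊥) : 2 ≤ finrank ℝ V := by
  rw [finrank_eq_subRank hV, subRank_eq_two_mul_finrank Φ hV hVc]
  have := finrank_cxSpan_pos Φ hV hVc hV0
  omega

/-- **Elliptic-curve factors are indecomposable**: a complex lattice subspace of real dimension `2`
(a `1`-dimensional abelian subvariety) admits no product pair inside.
[cite: Debarre1996PolarisationsProduits, p. 631 (definition of «indécomposable»)] -/
theorem isIndecomposable_of_finrank_eq_two {U : Submodule ℝ (ι → ℝ)} (hUl : IsLatticeSubspace U)
    (hUc : IsComplexSubspace Φ U) (h2 : finrank ℝ U = 2) : IsIndecomposable Φ η U := by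
  refine ⟨fun h ↦ by rw [h, finrank_bot] at h2; exact two_ne_zero h2.symm, hUl, hUc, fun V W hp ↦ ?_⟩
  by_contra hne
  push Not at hne
  have hV := two_le_finrank_of_isComplexSubspace hp.isLatticeSubspace_left hp.isComplexSubspace_left hne.1
  have hW := two_le_finrank_of_isComplexSubspace hp.isLatticeSubspace_right hp.isComplexSubspace_right hne.2
  have hdim := Submodule.finrank_sup_add_finrank_inf_eq V W
  rw [hp.sup_eq, hp.disjoint.eq_bot, finrank_bot, add_zero] at hdim
  omega

/-- **Polarised tori of dimension `< 2` (elliptic curves) are indecomposable.**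
[cite: Debarre1996PolarisationsProduits, p. 631 (definition of «indécomposable»)] -/
theorem isIndecomposable_top_of_card_lt_four [DecidableEq ι] [Nonempty ι] (h : Fintype.card ι < 4) :
    IsIndecomposable Φ η ⊤ :=
  isIndecomposable_top_iff.2 (not_isPolarizedDecomposable_of_card_lt_four Φ h)

/-- **An indecomposable polarised torus is its own unique factor**: `polarizedComponents = {Λ ⊗ ℝ}`.
[cite: Debarre1996PolarisationsProduits, Corollaire 2 b)] -/
theorem IsIndecomposable.polarizedComponents_eq_singleton_top [DecidableEq ι] (hη : IsRiemannForm Φ η)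
    (h : IsIndecomposable Φ η ⊤) : polarizedComponents Φ η = {⊤} := by
  have hF : IsProductFamily Φ η (fun _ : Unit ↦ (⊤ : Submodule ℝ (ι → ℝ))) :=
    { isLatticeSubspace := fun _ ↦ isLatticeSubspace_top
      isComplexSubspace := fun _ ↦ isComplexSubspace_top Φ
      orthogonal := fun i j hne ↦ absurd (Subsingleton.elim i j) hne
      iSupIndep := fun i ↦ by
        have : (⨆ (j : Unit) (_ : j ≠ i), (⊤ : Submodule ℝ (ι → ℝ))) = ⊥ :=
          iSup₂_eq_bot.2 fun j hj ↦ absurd (Subsingleton.elim j i) hj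
        rw [this]
        exact disjoint_bot_right
      iSup_subLattice := by rw [iSup_const, subLattice_top] }
  rw [← hF.range_eq_polarizedComponents (fun _ ↦ h) hη, Set.range_const]

/-- **A product pair of indecomposables exhibits the two unique factors**: if `(X, η) = (Y, η|Y) × (Z, η|Z)`
with `Y`, `Z` indecomposable, then `polarizedComponents = {V, W}`.
[cite: Debarre1996PolarisationsProduits, Corollaire 2 b)] -/
theorem IsProductPair.polarizedComponents_eq_pair [DecidableEq ι] {V W : Submodule ℝ (ι → ℝ)}
    (hp : IsProductPair Φ η V W) (hV : IsIndecomposable Φ η V) (hW : IsIndecomposable Φ η W)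
    (hη : IsRiemannForm Φ η) : polarizedComponents Φ η = {V, W} := by
  rw [← hp.isProductFamily.range_eq_polarizedComponents (fun b ↦ by cases b <;> assumption) hη]
  ext U
  simp only [Set.mem_range, Bool.exists_bool, cond_false, cond_true, mem_insert_iff, mem_singleton_iff]
  tauto

end Validation

end ComplexTorus

end Literature.Geometry.Kaehler

end
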